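import Summits.Ventures.PercRepro.SingleMerge

/-!
# Single-merge certificates (three marked vertices): integer matrices checked by `decide`

`quad_nonneg_of_moves` turns any real `5 × 5` matrix `A` with nonnegative diagonal and
nonpositive bilinear form on the seven move vectors into the theorem
`∑ i j, A i j π i π j ≥ 0` for the partition law `π = (x, y₁, y₂, y₃, z)` of three marked
vertices.  For an **integer** matrix both conditions are a finite computation (`SMCCert A`,
decidable), so every integer point of the single-merge cone — e.g. every extreme ray produced by
an exact double-description run, scaled to integers — becomes a Lean theorem by
`quad_nonneg_of_cert A (by decide)` (`smc_of_cert` gives the unfolded statement).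
The pair-sum matrix doubled, `pairSumCert`, is the worked example.
-/

namespace PercRepro

open Finset

/-- The integer bilinear form `∑ i, ∑ j, A i j * x i * y j`. -/
def ibilin (A : Fin 5 → Fin 5 → ℤ) (x y : Fin 5 → ℤ) : ℤ := ∑ i, ∑ j, A i j * x i * y j

/-- `ibilin` is the integer version of `bilin`. -/
theorem bilin_intCast (A : Fin 5 → Fin 5 → ℤ) (x y : Fin 5 → ℤ) :
    bilin (fun i j => (A i j : ℝ)) (fun i => (x i : ℝ)) (fun j => (y j : ℝ)) =
      (ibilin A x y : ℝ) := by
  simp [bilin, ibilin]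

namespace MultiGraph

/-- **Single-merge certificate** of an integer matrix `A` indexed by the partitions
`abc, ab|c, ac|b, bc|a, a|b|c`: nonnegative diagonal and nonpositive bilinear form on every
ordered pair of move vectors.  Decidable: check it with `by decide`. -/
def SMCCert (A : Fin 5 → Fin 5 → ℤ) : Prop :=
  (∀ i, 0 ≤ A i i) ∧ ∀ mv mv' : Move, ibilin A mv.ivec mv'.ivec ≤ 0

/-- The certificate is a finite check. -/
instance (A : Fin 5 → Fin 5 → ℤ) : Decidable (SMCCert A) := by
  unfold SMCCert
  infer_instance

variable {E : Type*} [Fintype E] [DecidableEq E] {V : Type*} (G : MultiGraph V E)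

/-- A certified integer matrix gives a nonnegative quadratic form of the partition law. -/
theorem quad_nonneg_of_cert (A : Fin 5 → Fin 5 → ℤ) (hA : SMCCert A) (p : E → ℝ)
    (hp : IsProb p) (a b c : V) :
    0 ≤ bilin (fun i j => (A i j : ℝ)) (G.triLaw p a b c) (G.triLaw p a b c) := by
  refine G.quad_nonneg_of_moves _ (fun i => by exact_mod_cast hA.1 i) (fun mv mv' => ?_) p hp a b c
  have h := hA.2 mv mv'
  have hcast : bilin (fun i j => (A i j : ℝ)) mv.vec mv'.vec =
      (ibilin A mv.ivec mv'.ivec : ℝ) := bilin_intCast A mv.ivec mv'.ivec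
  rw [hcast]
  exact_mod_cast h

/-- The certified inequality, unfolded: `∑ i j, A i j · P(triEvent i) · P(triEvent j) ≥ 0`. -/
theorem smc_of_cert (A : Fin 5 → Fin 5 → ℤ) (hA : SMCCert A) (p : E → ℝ) (hp : IsProb p)
    (a b c : V) :
    0 ≤ ∑ i, ∑ j, (A i j : ℝ) * prob p (G.triEvent a b c i) * prob p (G.triEvent a b c j) :=
  G.quad_nonneg_of_cert A hA p hp a b c

/-- The pair-sum matrix, doubled to make it integral: `2 (x z - y₁ y₂ - y₁ y₃ - y₂ y₃)`. -/
def pairSumCert : Fin 5 → Fin 5 → ℤ :=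
  ![![0, 0, 0, 0, 1], ![0, 0, -1, -1, 0], ![0, -1, 0, -1, 0], ![0, -1, -1, 0, 0], ![1, 0, 0, 0, 0]]

/-- The pair-sum matrix is certified by the finite check. -/
theorem pairSumCert_smc : SMCCert pairSumCert := by decide

/-- The pair-sum inequality, re-derived from the certificate (the template for every
certified ray). -/
theorem pair_sum_of_cert (p : E → ℝ) (hp : IsProb p) (a b c : V) :
    prob p (G.connEvent a b ∩ G.sepEvent b c) * prob p (G.connEvent a c ∩ G.sepEvent a b) +
      prob p (G.connEvent a b ∩ G.sepEvent b c) * prob p (G.connEvent b c ∩ G.sepEvent a b) +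
      prob p (G.connEvent a c ∩ G.sepEvent a b) * prob p (G.connEvent b c ∩ G.sepEvent a b) ≤
    prob p (G.connEvent a b ∩ G.connEvent b c) *
      prob p (G.sepEvent a b ∩ G.sepEvent b c ∩ G.sepEvent a c) := by
  have h := G.smc_of_cert pairSumCert pairSumCert_smc p hp a b c
  simp [Fin.sum_univ_five, pairSumCert, triEvent] at h
  linarith

end MultiGraph

end PercRepro
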